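import Summits.QuantumFields.YangMills.Theorems.PoincareLipschitzRegaugedTowerInduction
import Summits.QuantumFields.YangMills.Theorems.PoincareLipschitzTowerReadingSets
import Summits.QuantumFields.YangMills.Theorems.PoincareLipschitzThresholdSums
import Summits.QuantumFields.YangMills.Theorems.PoincareLipschitzTrueLinBoxLocalRows
import Literature.MathematicalPhysics.QuantumFieldTheory.Balaban1983to89.BlockAveragingPlaquetteBoundLocal
import Literature.MathematicalPhysics.QuantumFieldTheory.Balaban1983to89.T3MinimiserStabilityReduction
import HarnessLib

/-!
# Crux stmt-QuantumFields-19936 `UnitScaleTilt.HistoryTailL`, K2 at depth (route crux `PoincareLipschitz.BlockLipschitzL`, stmt-QuantumFields-23533),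
# K2 supplier plan of record (card v1.27 (c)), file F5b-5b — «AVERAGE STABILITY MODULO GAUGE» IN THE SMALL-DATA REGIME: the displayed row `hStab`
# of the K2-TOP door ✓`PoincareLipschitzIteratedOfAvgStability` holds, `CS := 2√L`, on locally hierarchically good pairs with box-`ℓ²` distance `≤ (10⁷L⁶+1)⁻¹`

Cell `ym3-torus` (YM ladder rung R3 = continuum SU(2) Yang–Mills on the three-torus — a RUNG, NOT the Clay problem: not d = 4, not infinite volume,
not a mass gap); width seat `ym-ust-19936-w2` g10, pen F5 of the K2 supplier plan (LEAD `ym-ust-19936-w1` g7; memo `R4-LOCATE-w2g10.md` §3).  Helper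
`--supports stmt-QuantumFields-19936`; THEOREMS ONLY (0 `def`, 0 `sorry`).  NOT the unrestricted row (the regime `c_L < ‖X‖_{ℓ²(box)}` is (R3)'s);
nothing here proves a stub, `BlockLipschitzL`, `HistoryTailL` or a summit statement.
ASSEMBLY: the tower ✓`PoincareLipschitzRegaugedTowerInduction.exists_regauge_top_sum_normSq_le` on the `K`-th torus with the reading sets of
✓`PoincareLipschitzTowerReadingSets`, loop sizes `α_i := ((d+2)L)²/4·θBal(K−i)` from the windows (lit ✓`dist1_loopHol_le_local`), `Σθ` by
✓`PoincareLipschitzThresholdSums.exists_gamma_forall_sum_θBal_le`, `Σρ^i ≤ 5/2`, `X := ‖pertVar U U'‖_{ℓ²(S_0)} ≤ √(box sum)`, sup ≤ `ℓ²` on the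
footprints, ✓`dist1_mul_inv_eq_norm_pertVar`, `(√(L⁻³L²))^j√(L^{j+1}) = √L`.
WHAT IS PROVED (ns `…PoincareLipschitzAvgStabilitySmallData`): §1 numeric letters (`geom_sum_le_five_halves`, `rho_pow_mul_sqrt_eq`, `C1_le`, `kappa_div_rho_eq`); §2 ★★★ `avgStabilityModGauge_smallData` (hStab's hypotheses VERBATIM
`+ √(box sum) ≤ c` ⇒ hStab's conclusion VERBATIM, modulo the two box-local rows displayed `Params`-generically) and ★★★ `avgStabilityModGauge_smallData_rows`
(UNCONDITIONAL: the rows plugged by name from ✓`PoincareLipschitzTrueLinBoxLocalRows`, `ym3-torus-px7`, p683731).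
References: T. Bałaban, CMP 98 (1985) 17–51 [Balaban1985Averaging] (Props 1–3, (11), (62), §3 (156)–(163)); CMP 109 (1987) 249–301 [Balaban1987RG1] ((0.1)–(0.4),
(0.11)); CMP 102 (1985) 255–275 [Balaban1985UV3] ((7) p.257).
-/

noncomputable section

open scoped BigOperators Matrix.Norms.L2Operator
open NormedSpace

namespace Summit.QuantumFields.YangMills.Theorems.PoincareLipschitzAvgStabilitySmallData

open Literature.MathematicalPhysics.QuantumFieldTheory.Balaban1983to89
open Literature.MathematicalPhysics.QuantumFieldTheory.Balaban1983to89.T3ContinuumYM3Torus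
open Literature.MathematicalPhysics.QuantumFieldTheory.Balaban1983to89.T3UnitScaleTilt (θBal)
open Finset T4Continuum BlockAveraging AveragingRT ExpMeanLog BlockAveragingEMLLinearised BlockAveragingEMLLinearisedBackground
open Summit.QuantumFields.YangMills.Theorems.PoincareLipschitzRegaugedTowerInduction (exists_regauge_top_sum_normSq_le)
open Summit.QuantumFields.YangMills.Theorems.PoincareLipschitzTowerReadingSets (readingSet_closed window_of_readingSet footprint_mem_readingSet
  box_of_readingSet_zero)
open Summit.QuantumFields.YangMills.Theorems.PoincareLipschitzRegaugeAbsorption (dist1_mul_inv_eq_norm_pertVar)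
open Summit.QuantumFields.YangMills.Theorems.PoincareLipschitzThresholdSums (exists_gamma_forall_sum_θBal_le)
open BlockAveragingPlaquetteBoundLocal (dist1_loopHol_le_local)
open T3MinimiserStabilityReduction (θBal_pos)
open Summit.QuantumFields.YangMills.Theorems.PoincareLipschitzTrueLinBoxLocalRows (sum_normSq_line_le_local sum_nbhd_le_local)

/-! ## §1 Numeric letters -/

/-- The geometric sum of a ratio `0 ≤ ρ ≤ 3/5` is `≤ 5/2`. [folklore] -/
theorem geom_sum_le_five_halves {ρ : ℝ} (h0 : 0 ≤ ρ) (h1 : ρ ≤ 3 / 5) (n : ℕ) : ∑ i ∈ Finset.range n, ρ ^ i ≤ 5 / 2 := by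
  have hρ1 : ρ < 1 := by linarith
  have hs : ∑ i ∈ Finset.range n, ρ ^ i ≤ ∑' i, ρ ^ i :=
    (summable_geometric_of_lt_one h0 hρ1).sum_le_tsum _ (fun i _ => pow_nonneg h0 i)
  rw [tsum_geometric_of_lt_one h0 hρ1] at hs
  have : (1 - ρ)⁻¹ ≤ 5 / 2 := by
    rw [inv_le_comm₀ (by linarith) (by norm_num)]
    linarith
  exact hs.trans this

/-- `(√(L⁻³·L²))^j · √(L^{j+1}) = √L` for `L > 0`: the `L^{−j/2}` gain in hStab's letters. [folklore] -/
theorem rho_pow_mul_sqrt_eq {L : ℝ} (hL : 0 < L) (j : ℕ) :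
    Real.sqrt ((L ^ 3)⁻¹ * L ^ 2) ^ j * Real.sqrt (L ^ (j + 1)) = Real.sqrt L := by
  have hρ : (L ^ 3)⁻¹ * L ^ 2 = L⁻¹ := by field_simp
  rw [hρ]
  have h0 : 0 ≤ Real.sqrt L⁻¹ ^ j * Real.sqrt (L ^ (j + 1)) := by positivity
  have hsq : (Real.sqrt L⁻¹ ^ j * Real.sqrt (L ^ (j + 1))) ^ 2 = L := by
    rw [mul_pow, ← pow_mul, mul_comm j 2, pow_mul, Real.sq_sqrt (inv_nonneg.2 hL.le), Real.sq_sqrt (by positivity),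
      inv_pow, pow_succ, ← mul_assoc, inv_mul_cancel₀ (pow_ne_zero _ hL.ne'), one_mul]
  rw [← Real.sqrt_sq h0, hsq]

/-- `C₁ = 5L·√(6L³) ≤ 15L³` for `L ≥ 1`. [folklore] -/
theorem C1_le {L : ℝ} (hL : 1 ≤ L) : 5 * L * Real.sqrt (2 * 3 * L ^ 3) ≤ 15 * L ^ 3 := by
  have h : Real.sqrt (2 * 3 * L ^ 3) ≤ 3 * L ^ 2 := by
    rw [Real.sqrt_le_left (by positivity)]
    nlinarith [pow_pos (show 0 < L by linarith) 3, pow_nonneg (show 0 ≤ L by linarith) 4]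
  nlinarith [mul_le_mul_of_nonneg_left h (show 0 ≤ 5 * L by linarith)]

/-- `κ/ρ = 5L·√(6L³·6) / √(L⁻³L²) = 30L³` for `L > 0`. [folklore] -/
theorem kappa_div_rho_eq {L : ℝ} (hL : 0 < L) :
    5 * L * Real.sqrt (2 * 3 * L ^ 3 * (2 * 3)) / Real.sqrt ((L ^ 3)⁻¹ * L ^ 2) = 30 * L ^ 3 := by
  have hρ : (L ^ 3)⁻¹ * L ^ 2 = L⁻¹ := by field_simp
  have h36 : 2 * 3 * L ^ 3 * (2 * 3) = (6 * L) ^ 2 * L := by ring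
  have hs : Real.sqrt L * Real.sqrt L = L := Real.mul_self_sqrt hL.le
  rw [hρ, h36, Real.sqrt_mul (by positivity), Real.sqrt_sq (by positivity), Real.sqrt_inv, div_inv_eq_mul]
  linear_combination (30 * L ^ 2) * hs

/-! ## §2 The row in the small-data regime -/

set_option maxHeartbeats 600000 in
/-- ★★★ **«AVERAGE STABILITY MODULO GAUGE» IN THE SMALL-DATA REGIME.**  For every `L` there are `CS ≥ 0` (`:= 2√L`) and `c > 0` (`:= (10⁷L⁶ + 1)⁻¹`)
such that for all profiles `(b₀, p₀)` there is `γ₁ ∈ (0, 1]` such that for every `T3Family` with `F.L = L`, every `0 < γ ≤ γ₁`, `1 ≤ j`, `j + 3 ≤ K`,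
every level-`(j+1)` plaquette `a` and every pair `U, U'` of level-zero `SU(2)` fields which are locally hierarchically good around `a` up to height
`j` (hStab's windows VERBATIM) AND box-`ℓ²`-close, `√(Σ_{box} dist1(U_b U'_b⁻¹)²) ≤ c`, there is a level-`j` gauge transformation `h` with
`dist1(Ū^j(U)_b · ((Ū^j U')^h_b)⁻¹) ≤ CS/√(L^{j+1}) · √(Σ_{box} dist1(U_b U'_b⁻¹)²)` on the two-block footprints of the four bonds of `∂a` (hStab's
conclusion VERBATIM) — modulo the box-local rows ROW-L∕ROW-M, displayed `Params`-generically.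
[cite: Balaban1985Averaging, Props 1-3 (122)-(126) p.36, (156)-(163)] -/
theorem avgStabilityModGauge_smallData
    (hRowL : ∀ (P : Params) (i : ℕ), i + 1 ≤ P.m + P.K → ∀ (V : GaugeField P i (Matrix.specialUnitaryGroup (Fin 2) ℂ))
      (Z : PBond P i → Matrix (Fin 2) (Fin 2) ℂ) (T : Finset (PBond P (i + 1))) (S : Finset (PBond P i)),
      (∀ c ∈ T, ∀ b : PBond P i, (blockOf b.src = c.src ∨ blockOf b.src = c.tgt) → b ∈ S) →
      ∑ c ∈ T, ‖((Fintype.card (Idx P) : ℂ))⁻¹ • ∑ idx : Idx P,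
        ((holAt V (walk (emb c.src) (stairWord idx.2.1 (off idx.1))) : Matrix.specialUnitaryGroup (Fin 2) ℂ) : Matrix (Fin 2) (Fin 2) ℂ) *
          covWalkSum V Z (walk (walkEnd (emb c.src) (stairWord idx.2.1 (off idx.1))) (List.replicate P.L (c.dir, true))) *
        star ((holAt V (walk (emb c.src) (stairWord idx.2.1 (off idx.1))) : Matrix.specialUnitaryGroup (Fin 2) ℂ) : Matrix (Fin 2) (Fin 2) ℂ)‖ ^ 2
      ≤ ((P.L : ℝ) ^ P.d)⁻¹ * (P.L : ℝ) ^ 2 * ∑ b ∈ S, ‖Z b‖ ^ 2)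
    (hRowM : ∀ (P : Params) (i : ℕ), i + 1 ≤ P.m + P.K → ∀ (T : Finset (PBond P (i + 1))) (S : Finset (PBond P i)),
      (∀ c ∈ T, ∀ b : PBond P i, (blockOf b.src = c.src ∨ blockOf b.src = c.tgt) → b ∈ S) →
      ∀ g : PBond P i → ℝ, (∀ b, 0 ≤ g b) →
      ∑ c ∈ T, ∑ b ∈ univ.filter (fun b : PBond P i => blockOf b.src = c.src ∨ blockOf b.src = c.tgt), g b ≤ 2 * P.d * ∑ b ∈ S, g b) :
    ∀ (L : ℕ), ∃ CS : ℝ, 0 ≤ CS ∧ ∃ cX : ℝ, 0 < cX ∧ ∀ (b₀ p₀ : ℝ), 0 < b₀ → 2 < p₀ → ∃ γ₁ : ℝ, 0 < γ₁ ∧ γ₁ ≤ 1 ∧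
      ∀ (F : T3Family) (γ : ℝ), F.L = L → 0 < γ → γ ≤ γ₁ → ∀ (K j : ℕ), 1 ≤ j → j + 3 ≤ K →
      ∀ (a : Plaq (F.P K) (j + 1)) (U U' : GaugeField (F.P K) 0 (Matrix.specialUnitaryGroup (Fin 2) ℂ)),
      (∀ (i : ℕ) (q : Plaq (F.P K) i), i < j + 1 →
        Site.tdist (fun k => ((((q.src k).val * F.L ^ i : ℕ)) : ZMod ((F.P K).sitesPerDir 0)))
          (fun k => ((((a.src k).val * F.L ^ (j + 1) : ℕ)) : ZMod ((F.P K).sitesPerDir 0))) + 64 * F.L ^ i ≤ 64 * F.L ^ (j + 1) →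
        GaugeGroup.dist1 (GaugeField.plaqHol (Averaging.iter (fun i' => BlockAveraging.blockAvg (P := F.P K) (j := i') T3UnitLawDensityEML.ℰp) i U) q)
          < T3UnitScaleTilt.θBal F.L γ b₀ p₀ (K - i)) →
      (∀ (i : ℕ) (q : Plaq (F.P K) i), i < j + 1 →
        Site.tdist (fun k => ((((q.src k).val * F.L ^ i : ℕ)) : ZMod ((F.P K).sitesPerDir 0)))
          (fun k => ((((a.src k).val * F.L ^ (j + 1) : ℕ)) : ZMod ((F.P K).sitesPerDir 0))) + 64 * F.L ^ i ≤ 64 * F.L ^ (j + 1) →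
        GaugeGroup.dist1 (GaugeField.plaqHol (Averaging.iter (fun i' => BlockAveraging.blockAvg (P := F.P K) (j := i') T3UnitLawDensityEML.ℰp) i U') q)
          < T3UnitScaleTilt.θBal F.L γ b₀ p₀ (K - i)) →
      Real.sqrt (∑ b : PBond (F.P K) 0, if (∀ k, (b.src k - ((((a.src k).val * F.L ^ (j + 1) : ℕ)) : ZMod ((F.P K).sitesPerDir 0)) +
            ((8 * F.L ^ (j + 1) : ℕ) : ZMod ((F.P K).sitesPerDir 0))).val < 17 * F.L ^ (j + 1)) ∧
          (∀ k, (b.tgt k - ((((a.src k).val * F.L ^ (j + 1) : ℕ)) : ZMod ((F.P K).sitesPerDir 0)) +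
            ((8 * F.L ^ (j + 1) : ℕ) : ZMod ((F.P K).sitesPerDir 0))).val < 17 * F.L ^ (j + 1))
          then GaugeGroup.dist1 (U b * (U' b)⁻¹) ^ 2 else 0) ≤ cX →
      ∃ h : GaugeTransf (F.P K) j (Matrix.specialUnitaryGroup (Fin 2) ℂ), ∀ c : PBond (F.P K) (j + 1),
        (c = ⟨a.src, a.μ⟩ ∨ c = ⟨a.src.shift a.μ, a.ν⟩ ∨ c = ⟨a.src.shift a.ν, a.μ⟩ ∨ c = ⟨a.src, a.ν⟩) →
        ∀ b : PBond (F.P K) j, (blockOf b.src = c.src ∨ blockOf b.src = c.tgt) → (blockOf b.tgt = c.src ∨ blockOf b.tgt = c.tgt) →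
          GaugeGroup.dist1 (Averaging.iter (fun i' => BlockAveraging.blockAvg (P := F.P K) (j := i') T3UnitLawDensityEML.ℰp) j U b *
              (GaugeField.gaugeAct h (Averaging.iter (fun i' => BlockAveraging.blockAvg (P := F.P K) (j := i') T3UnitLawDensityEML.ℰp) j U') b)⁻¹)
            ≤ CS / Real.sqrt ((F.L : ℝ) ^ (j + 1)) *
              Real.sqrt (∑ b : PBond (F.P K) 0, if (∀ k, (b.src k - ((((a.src k).val * F.L ^ (j + 1) : ℕ)) : ZMod ((F.P K).sitesPerDir 0)) +
                  ((8 * F.L ^ (j + 1) : ℕ) : ZMod ((F.P K).sitesPerDir 0))).val < 17 * F.L ^ (j + 1)) ∧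
                (∀ k, (b.tgt k - ((((a.src k).val * F.L ^ (j + 1) : ℕ)) : ZMod ((F.P K).sitesPerDir 0)) +
                  ((8 * F.L ^ (j + 1) : ℕ) : ZMod ((F.P K).sitesPerDir 0))).val < 17 * F.L ^ (j + 1))
                then GaugeGroup.dist1 (U b * (U' b)⁻¹) ^ 2 else 0) := by
  intro L
  refine ⟨2 * Real.sqrt L, by positivity, 1 / (10 ^ 7 * (L : ℝ) ^ 6 + 1), by positivity, ?_⟩
  intro b₀ p₀ hb hp
  obtain ⟨γ₁, hγ₁, hγ₁1, hθsum⟩ := exists_gamma_forall_sum_θBal_le hb (by linarith : (0 : ℝ) < p₀)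
    (σ := 1 / (10 ^ 6 * (L : ℝ) ^ 5 + 1)) (by positivity)
  refine ⟨γ₁, hγ₁, hγ₁1, ?_⟩
  intro F γ hFL hγ hγle K j hj1 hjK a U U' hU hU' hsmallX
  subst hFL
  obtain ⟨Bx, hBx⟩ : ∃ Bx : ℝ, Bx = ∑ b : PBond (F.P K) 0, (if (∀ k, (b.src k - ((((a.src k).val * F.L ^ (j + 1) : ℕ)) : ZMod ((F.P K).sitesPerDir 0)) +
            ((8 * F.L ^ (j + 1) : ℕ) : ZMod ((F.P K).sitesPerDir 0))).val < 17 * F.L ^ (j + 1)) ∧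
          (∀ k, (b.tgt k - ((((a.src k).val * F.L ^ (j + 1) : ℕ)) : ZMod ((F.P K).sitesPerDir 0)) +
            ((8 * F.L ^ (j + 1) : ℕ) : ZMod ((F.P K).sitesPerDir 0))).val < 17 * F.L ^ (j + 1))
          then GaugeGroup.dist1 (U b * (U' b)⁻¹) ^ 2 else 0) := ⟨_, rfl⟩
  rw [← hBx] at hsmallX ⊢
  have hL3 : 3 ≤ F.L := (by obtain ⟨k, hk⟩ := F.hL.1; have := F.hL.2; omega)
  have hLr : (3 : ℝ) ≤ (F.L : ℝ) := by exact_mod_cast hL3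
  have hL1r : (1 : ℝ) ≤ (F.L : ℝ) := by linarith
  have hLpos : (0 : ℝ) < (F.L : ℝ) := by linarith
  have hd : (F.P K).d = 3 := rfl
  have hPL : (F.P K).L = F.L := rfl
  have hmK : (F.P K).m + (F.P K).K = F.m + K := rfl
  have hm := F.hm
  obtain ⟨S, hSdef⟩ : ∃ S : (i : ℕ) → Finset (PBond (F.P K) i), S = fun i => univ.filter (fun b : PBond (F.P K) i =>
    Site.tdist (fun k => ((((b.src k).val * F.L ^ i : ℕ)) : ZMod ((F.P K).sitesPerDir 0)))
        (fun k => ((((a.src k).val * F.L ^ (j + 1) : ℕ)) : ZMod ((F.P K).sitesPerDir 0))) + 2 * F.L ^ (i + 1) ≤ 8 * F.L ^ (j + 1)) := ⟨_, rfl⟩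
  have hmemS : ∀ i (b : PBond (F.P K) i), b ∈ S i ↔
      Site.tdist (fun k => ((((b.src k).val * F.L ^ i : ℕ)) : ZMod ((F.P K).sitesPerDir 0)))
        (fun k => ((((a.src k).val * F.L ^ (j + 1) : ℕ)) : ZMod ((F.P K).sitesPerDir 0))) + 2 * F.L ^ (i + 1) ≤ 8 * F.L ^ (j + 1) := by
    intro i b; rw [hSdef]; simp only [Finset.mem_filter, Finset.mem_univ, true_and]
  have hS : ∀ i, i < j → ∀ c ∈ S (i + 1), ∀ b : PBond (F.P K) i, (blockOf b.src = c.src ∨ blockOf b.src = c.tgt) → b ∈ S i := by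
    intro i hi c hc b hb
    rw [hmemS] at hc ⊢
    refine readingSet_closed F K (by omega) a.src c.src c.dir hc b.src ?_
    rcases hb with h | h
    · exact Or.inr (Or.inl h)
    · exact Or.inr (Or.inr h)
  obtain ⟨α, hαdef⟩ : ∃ α : ℕ → ℝ, α = fun i => (((((F.P K).d + 2) * (F.P K).L : ℕ) : ℝ)) ^ 2 / 4 * θBal F.L γ b₀ p₀ (K - i) := ⟨_, rfl⟩
  have hθ0 : ∀ i, 0 ≤ θBal F.L γ b₀ p₀ (K - i) := fun i => (θBal_pos (by omega) hγ (hγle.trans hγ₁1) hb p₀ _).le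
  have hα0 : ∀ i, i < j → 0 ≤ α i := fun i _ => by rw [hαdef]; exact mul_nonneg (by positivity) (hθ0 i)
  have hα : ∀ i, i < j → ∀ c ∈ S (i + 1), ∀ idx : Idx (F.P K),
      dist1 (loopHol (Averaging.iter (fun i' => BlockAveraging.blockAvg (P := F.P K) (j := i') (expMeanLogSU (n := Fin 2))) i U) c idx) ≤ α i := by
    intro i hi c hc idx
    rw [hmemS] at hc
    rw [hαdef]
    refine dist1_loopHol_le_local (hθ0 i) (by show i + 1 ≤ F.m + K; omega) c (fun q hq => ?_) idx
    have hq' : blockOf q.src = c.src.unshift c.dir ∨ blockOf q.src = c.src ∨ blockOf q.src = c.src.shift c.dir := hq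
    have hwin := window_of_readingSet F K (show i ≤ j by omega) a.src q.src (readingSet_closed F K (by omega) a.src c.src c.dir hc q.src hq')
    exact hU i q (by omega) hwin
  have hθsum' : ∑ i ∈ Finset.range j, θBal F.L γ b₀ p₀ (K - i) ≤ 1 / (10 ^ 6 * (F.L : ℝ) ^ 5 + 1) := by
    have hinj : Set.InjOn (fun i => K - i) ↑(Finset.range j) := by
      intro i₁ hi₁ i₂ hi₂ h
      have := Finset.mem_range.1 (Finset.mem_coe.1 hi₁); have := Finset.mem_range.1 (Finset.mem_coe.1 hi₂)
      simp only at h; omega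
    rw [← Finset.sum_image hinj]
    exact hθsum F.L (by omega) γ hγ hγle _
  have hθle : ∀ i, i < j → θBal F.L γ b₀ p₀ (K - i) ≤ 1 / (10 ^ 6 * (F.L : ℝ) ^ 5 + 1) := fun i hi =>
    (Finset.single_le_sum (f := fun i => θBal F.L γ b₀ p₀ (K - i)) (fun i _ => hθ0 i) (Finset.mem_range.2 hi)).trans hθsum'
  obtain ⟨X, hXdef⟩ : ∃ X : ℝ, X = Real.sqrt (∑ b ∈ S 0, ‖pertVar U U' b‖ ^ 2) := ⟨_, rfl⟩
  have hX0 : 0 ≤ X := by rw [hXdef]; exact Real.sqrt_nonneg _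
  have hXsq : ∑ b ∈ S 0, ‖pertVar U U' b‖ ^ 2 ≤ X ^ 2 := by rw [hXdef, Real.sq_sqrt (Finset.sum_nonneg fun _ _ => sq_nonneg _)]
  have hpert : ∀ b : PBond (F.P K) 0, ‖pertVar U U' b‖ = GaugeGroup.dist1 (U b * (U' b)⁻¹) := by
    intro b
    rw [← dist1_mul_inv_eq_norm_pertVar U U' b, show U b * (U' b)⁻¹ = (U' b * (U b)⁻¹)⁻¹ by rw [mul_inv_rev, inv_inv], GaugeGroup.dist1_inv]
  have hXbox : ∑ b ∈ S 0, ‖pertVar U U' b‖ ^ 2 ≤ Bx := by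
    rw [hBx]
    have hsub : S 0 ⊆ univ.filter (fun b : PBond (F.P K) 0 =>
        (∀ k, (b.src k - ((((a.src k).val * F.L ^ (j + 1) : ℕ)) : ZMod ((F.P K).sitesPerDir 0)) +
            ((8 * F.L ^ (j + 1) : ℕ) : ZMod ((F.P K).sitesPerDir 0))).val < 17 * F.L ^ (j + 1)) ∧
          (∀ k, (b.tgt k - ((((a.src k).val * F.L ^ (j + 1) : ℕ)) : ZMod ((F.P K).sitesPerDir 0)) +
            ((8 * F.L ^ (j + 1) : ℕ) : ZMod ((F.P K).sitesPerDir 0))).val < 17 * F.L ^ (j + 1))) := by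
      intro b hb
      rw [hmemS] at hb
      exact Finset.mem_filter.2 ⟨Finset.mem_univ _, box_of_readingSet_zero F K a.src b hb⟩
    rw [← Finset.sum_filter]
    calc ∑ b ∈ S 0, ‖pertVar U U' b‖ ^ 2 = ∑ b ∈ S 0, GaugeGroup.dist1 (U b * (U' b)⁻¹) ^ 2 :=
          Finset.sum_congr rfl fun b _ => by rw [hpert]
      _ ≤ _ := Finset.sum_le_sum_of_subset_of_nonneg hsub fun _ _ _ => sq_nonneg _
  have hXc : X ≤ 1 / (10 ^ 7 * (F.L : ℝ) ^ 6 + 1) := by rw [hXdef]; exact (Real.sqrt_le_sqrt hXbox).trans hsmallX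
  have hC₁ : (((((F.P K).d + 2) * (F.P K).L : ℕ) : ℝ)) * Real.sqrt (2 * (F.P K).d * ((F.P K).L : ℝ) ^ (F.P K).d) ≤ 15 * (F.L : ℝ) ^ 3 := by
    rw [hd, hPL]; push_cast; exact C1_le hL1r
  have hC₁0 : 0 ≤ (((((F.P K).d + 2) * (F.P K).L : ℕ) : ℝ)) * Real.sqrt (2 * (F.P K).d * ((F.P K).L : ℝ) ^ (F.P K).d) := by positivity
  have hκρ : (((((F.P K).d + 2) * (F.P K).L : ℕ) : ℝ)) * Real.sqrt (2 * (F.P K).d * ((F.P K).L : ℝ) ^ (F.P K).d * (2 * (F.P K).d)) / Real.sqrt ((((F.P K).L : ℝ) ^ (F.P K).d)⁻¹ * ((F.P K).L : ℝ) ^ 2)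
      = 30 * (F.L : ℝ) ^ 3 := by
    rw [hd, hPL]; push_cast; exact kappa_div_rho_eq hLpos
  have hρ1 : (((F.P K).L : ℝ) ^ (F.P K).d)⁻¹ * ((F.P K).L : ℝ) ^ 2 ≤ 1 := by
    rw [hd, hPL, inv_mul_le_iff₀ (by positivity)]
    nlinarith [pow_le_pow_right₀ hL1r (show 2 ≤ 3 by norm_num)]
  have hρ35 : Real.sqrt ((((F.P K).L : ℝ) ^ (F.P K).d)⁻¹ * ((F.P K).L : ℝ) ^ 2) ≤ 3 / 5 := by
    rw [hd, hPL, show ((F.L : ℝ) ^ 3)⁻¹ * (F.L : ℝ) ^ 2 = (F.L : ℝ)⁻¹ by field_simp]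
    rw [Real.sqrt_le_left (by norm_num), inv_le_comm₀ hLpos (by norm_num)]
    linarith
  have hρ0 : 0 ≤ Real.sqrt ((((F.P K).L : ℝ) ^ (F.P K).d)⁻¹ * ((F.P K).L : ℝ) ^ 2) := Real.sqrt_nonneg _
  have hL6 : (F.L : ℝ) ^ 3 ≤ (F.L : ℝ) ^ 6 := pow_le_pow_right₀ hL1r (by norm_num)
  have hCX : (((((F.P K).d + 2) * (F.P K).L : ℕ) : ℝ)) * Real.sqrt (2 * (F.P K).d * ((F.P K).L : ℝ) ^ (F.P K).d) * X ≤ 1 / 100000 := by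
    have h1 : (((((F.P K).d + 2) * (F.P K).L : ℕ) : ℝ)) * Real.sqrt (2 * (F.P K).d * ((F.P K).L : ℝ) ^ (F.P K).d) * X ≤ 15 * (F.L : ℝ) ^ 3 * (1 / (10 ^ 7 * (F.L : ℝ) ^ 6 + 1)) :=
      mul_le_mul hC₁ hXc hX0 (by positivity)
    refine h1.trans ?_
    rw [mul_one_div, div_le_div_iff₀ (by positivity) (by norm_num)]
    nlinarith
  have hsmallX' : 144 * ((((((F.P K).d + 2) * (F.P K).L : ℕ) : ℝ)) * Real.sqrt (2 * (F.P K).d * ((F.P K).L : ℝ) ^ (F.P K).d) * X) ≤ 1 := by linarith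
  have hL5 : (F.L : ℝ) ^ 2 ≤ (F.L : ℝ) ^ 5 := pow_le_pow_right₀ hL1r (by norm_num)
  have h5 : (((((F.P K).d + 2) * (F.P K).L : ℕ) : ℝ)) = 5 * (F.L : ℝ) := by rw [hd, hPL]; push_cast; ring
  have hαi : ∀ i, α i = (5 * (F.L : ℝ)) ^ 2 / 4 * θBal F.L γ b₀ p₀ (K - i) := fun i => by simp only [hαdef, h5]
  have hαle : ∀ i, i < j → α i ≤ 1 / 100000 := by
    intro i hi
    rw [hαi]
    have h1 : (5 * (F.L : ℝ)) ^ 2 / 4 * θBal F.L γ b₀ p₀ (K - i) ≤ (5 * (F.L : ℝ)) ^ 2 / 4 * (1 / (10 ^ 6 * (F.L : ℝ) ^ 5 + 1)) :=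
      mul_le_mul_of_nonneg_left (hθle i hi) (by positivity)
    refine h1.trans ?_
    rw [mul_one_div, div_le_div_iff₀ (by positivity) (by norm_num)]
    nlinarith
  have hα24 : ∀ i, i < j → α i ≤ 1 / 24 := fun i hi => (hαle i hi).trans (by norm_num)
  have hN : ∀ i, i < j → 6 * ((((((F.P K).d + 2) * (F.P K).L : ℕ) : ℝ)) * Real.sqrt (2 * (F.P K).d * ((F.P K).L : ℝ) ^ (F.P K).d) * X) + α i < deltaSU (Fin 2) := by
    intro i hi
    have := hαle i hi
    have hδ : (1 : ℝ) / 3 ≤ deltaSU (Fin 2) := by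
      unfold deltaSU
      rw [Fintype.card_fin]
      refine le_min le_rfl ?_
      have := Real.pi_gt_three
      push_cast
      linarith
    linarith
  have hsum : (((((F.P K).d + 2) * (F.P K).L : ℕ) : ℝ)) * Real.sqrt (2 * (F.P K).d * ((F.P K).L : ℝ) ^ (F.P K).d * (2 * (F.P K).d)) / Real.sqrt ((((F.P K).L : ℝ) ^ (F.P K).d)⁻¹ * ((F.P K).L : ℝ) ^ 2)
      * ∑ i ∈ Finset.range j, (159 * α i + 1040 * ((((((F.P K).d + 2) * (F.P K).L : ℕ) : ℝ)) * Real.sqrt (2 * (F.P K).d * ((F.P K).L : ℝ) ^ (F.P K).d))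
        * Real.sqrt ((((F.P K).L : ℝ) ^ (F.P K).d)⁻¹ * ((F.P K).L : ℝ) ^ 2) ^ i * X) ≤ 1 / 2 := by
    rw [hκρ]
    set C₁ := (((((F.P K).d + 2) * (F.P K).L : ℕ) : ℝ)) * Real.sqrt (2 * (F.P K).d * ((F.P K).L : ℝ) ^ (F.P K).d) with hC₁def
    set ρ := Real.sqrt ((((F.P K).L : ℝ) ^ (F.P K).d)⁻¹ * ((F.P K).L : ℝ) ^ 2) with hρdef
    have hsplit : ∑ i ∈ Finset.range j, (159 * α i + 1040 * C₁ * ρ ^ i * X)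
        = 159 * ∑ i ∈ Finset.range j, α i + 1040 * C₁ * X * ∑ i ∈ Finset.range j, ρ ^ i := by
      rw [Finset.sum_add_distrib, Finset.mul_sum, Finset.mul_sum]
      refine congrArg₂ (· + ·) rfl (Finset.sum_congr rfl fun i _ => by ring)
    rw [hsplit]
    have hSumA : ∑ i ∈ Finset.range j, α i ≤ (5 * (F.L : ℝ)) ^ 2 / 4 * (1 / (10 ^ 6 * (F.L : ℝ) ^ 5 + 1)) := by
      have : ∑ i ∈ Finset.range j, α i = (5 * (F.L : ℝ)) ^ 2 / 4 * ∑ i ∈ Finset.range j, θBal F.L γ b₀ p₀ (K - i) := by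
        rw [Finset.mul_sum]; exact Finset.sum_congr rfl fun i _ => hαi i
      rw [this]
      exact mul_le_mul_of_nonneg_left hθsum' (by positivity)
    have hSumR : ∑ i ∈ Finset.range j, ρ ^ i ≤ 5 / 2 := geom_sum_le_five_halves hρ0 hρ35 j
    have hCXρ : 1040 * C₁ * X * ∑ i ∈ Finset.range j, ρ ^ i ≤ 1040 * (1 / 100000) * (5 / 2) := by
      have h1 : 1040 * C₁ * X * ∑ i ∈ Finset.range j, ρ ^ i ≤ 1040 * C₁ * X * (5 / 2) :=
        mul_le_mul_of_nonneg_left hSumR (by positivity)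
      nlinarith [mul_nonneg hC₁0 hX0]
    have hα25 : 159 * ∑ i ∈ Finset.range j, α i ≤ 159 * ((5 * (F.L : ℝ)) ^ 2 / 4 * (1 / (10 ^ 6 * (F.L : ℝ) ^ 5 + 1))) :=
      mul_le_mul_of_nonneg_left hSumA (by norm_num)
    have hL30 : (0 : ℝ) ≤ 30 * (F.L : ℝ) ^ 3 := by positivity
    have hkey1 : 30 * (F.L : ℝ) ^ 3 * (159 * ((5 * (F.L : ℝ)) ^ 2 / 4 * (1 / (10 ^ 6 * (F.L : ℝ) ^ 5 + 1)))) ≤ 1 / 4 := by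
      rw [show 30 * (F.L : ℝ) ^ 3 * (159 * ((5 * (F.L : ℝ)) ^ 2 / 4 * (1 / (10 ^ 6 * (F.L : ℝ) ^ 5 + 1))))
          = (30 * 159 * 25 / 4) * (F.L : ℝ) ^ 5 / (10 ^ 6 * (F.L : ℝ) ^ 5 + 1) by ring]
      rw [div_le_div_iff₀ (by positivity) (by norm_num)]
      nlinarith [pow_nonneg hLpos.le 5]
    have hCXρ' : 30 * (F.L : ℝ) ^ 3 * (1040 * C₁ * X * ∑ i ∈ Finset.range j, ρ ^ i) ≤ 1 / 4 := by
      have h1 : C₁ * X ≤ 15 * (F.L : ℝ) ^ 3 * (1 / (10 ^ 7 * (F.L : ℝ) ^ 6 + 1)) := mul_le_mul hC₁ hXc hX0 (by positivity)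
      have h2 : 1040 * C₁ * X * ∑ i ∈ Finset.range j, ρ ^ i ≤ 1040 * (15 * (F.L : ℝ) ^ 3 * (1 / (10 ^ 7 * (F.L : ℝ) ^ 6 + 1))) * (5 / 2) := by
        have hs0 : 0 ≤ ∑ i ∈ Finset.range j, ρ ^ i := Finset.sum_nonneg fun i _ => pow_nonneg hρ0 i
        calc 1040 * C₁ * X * ∑ i ∈ Finset.range j, ρ ^ i = 1040 * (C₁ * X) * ∑ i ∈ Finset.range j, ρ ^ i := by ring
          _ ≤ 1040 * (15 * (F.L : ℝ) ^ 3 * (1 / (10 ^ 7 * (F.L : ℝ) ^ 6 + 1))) * (5 / 2) :=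
            mul_le_mul (mul_le_mul_of_nonneg_left h1 (by norm_num)) hSumR hs0 (by positivity)
      refine (mul_le_mul_of_nonneg_left h2 hL30).trans ?_
      rw [show 30 * (F.L : ℝ) ^ 3 * (1040 * (15 * (F.L : ℝ) ^ 3 * (1 / (10 ^ 7 * (F.L : ℝ) ^ 6 + 1))) * (5 / 2))
          = (30 * 1040 * 15 * 5 / 2) * (F.L : ℝ) ^ 6 / (10 ^ 7 * (F.L : ℝ) ^ 6 + 1) by ring]
      rw [div_le_div_iff₀ (by positivity) (by norm_num)]
      nlinarith [pow_nonneg hLpos.le 6]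
    have hSumA0 : 0 ≤ ∑ i ∈ Finset.range j, α i := Finset.sum_nonneg fun i hi => hα0 i (Finset.mem_range.1 hi)
    nlinarith [mul_le_mul_of_nonneg_left hα25 hL30]
  have hRowL' : ∀ i, i < j → ∀ (V W : GaugeField (F.P K) i (Matrix.specialUnitaryGroup (Fin 2) ℂ)),
      ∑ c ∈ S (i + 1), ‖((Fintype.card (Idx (F.P K)) : ℂ))⁻¹ • ∑ idx : Idx (F.P K),
        ((holAt V (walk (emb c.src) (stairWord idx.2.1 (off idx.1))) : Matrix.specialUnitaryGroup (Fin 2) ℂ) : Matrix (Fin 2) (Fin 2) ℂ) *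
          covWalkSum V (pertVar V W) (walk (walkEnd (emb c.src) (stairWord idx.2.1 (off idx.1))) (List.replicate (F.P K).L (c.dir, true))) *
        star ((holAt V (walk (emb c.src) (stairWord idx.2.1 (off idx.1))) : Matrix.specialUnitaryGroup (Fin 2) ℂ) : Matrix (Fin 2) (Fin 2) ℂ)‖ ^ 2
      ≤ (((F.P K).L : ℝ) ^ (F.P K).d)⁻¹ * ((F.P K).L : ℝ) ^ 2 * ∑ b ∈ S i, ‖pertVar V W b‖ ^ 2 :=
    fun i hi V W => hRowL (F.P K) i (by show i + 1 ≤ F.m + K; omega) V (pertVar V W) (S (i + 1)) (S i) (hS i hi)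
  have hRowM' : ∀ i, i < j → ∀ g : PBond (F.P K) i → ℝ, (∀ b, 0 ≤ g b) →
      ∑ c ∈ S (i + 1), ∑ b ∈ univ.filter (fun b : PBond (F.P K) i => blockOf b.src = c.src ∨ blockOf b.src = c.tgt), g b ≤ 2 * (F.P K).d * ∑ b ∈ S i, g b :=
    fun i hi g hg => hRowM (F.P K) i (by show i + 1 ≤ F.m + K; omega) (S (i + 1)) (S i) (hS i hi) g hg
  obtain ⟨h, hh⟩ := exists_regauge_top_sum_normSq_le (P := F.P K) (k := j) (by show j ≤ F.m + K; omega) U U' S hS α hα0 hα24 hα hX0 hXsq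
    hρ1 hsmallX' hN hsum hRowL' hRowM'
  refine ⟨h, fun c₀ hc₀ b hb _ => ?_⟩
  have hbS : b ∈ S j := by rw [hmemS]; exact footprint_mem_readingSet F K (by omega) a c₀ hc₀ b hb
  obtain ⟨V, hVdef⟩ : ∃ V, V = Averaging.iter (fun i' => BlockAveraging.blockAvg (P := F.P K) (j := i') (expMeanLogSU (n := Fin 2))) j U := ⟨_, rfl⟩
  obtain ⟨W, hWdef⟩ : ∃ W, W = GaugeField.gaugeAct h
    (Averaging.iter (fun i' => BlockAveraging.blockAvg (P := F.P K) (j := i') (expMeanLogSU (n := Fin 2))) j U') := ⟨_, rfl⟩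
  rw [← hVdef, ← hWdef] at hh
  have hsingle : ‖pertVar V W b‖ ^ 2 ≤ (2 * Real.sqrt ((((F.P K).L : ℝ) ^ (F.P K).d)⁻¹ * ((F.P K).L : ℝ) ^ 2) ^ j * X) ^ 2 :=
    (Finset.single_le_sum (f := fun b => ‖pertVar V W b‖ ^ 2) (fun _ _ => sq_nonneg _) hbS).trans hh
  have hnorm : ‖pertVar V W b‖ ≤ 2 * Real.sqrt ((((F.P K).L : ℝ) ^ (F.P K).d)⁻¹ * ((F.P K).L : ℝ) ^ 2) ^ j * X :=
    (pow_le_pow_iff_left₀ (norm_nonneg _) (by positivity) two_ne_zero).1 hsingle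
  have hdist : GaugeGroup.dist1 (V b * (W b)⁻¹) = ‖pertVar V W b‖ := by
    rw [show V b * (W b)⁻¹ = (W b * (V b)⁻¹)⁻¹ by rw [mul_inv_rev, inv_inv], GaugeGroup.dist1_inv]
    exact dist1_mul_inv_eq_norm_pertVar V W b
  have hgoal : GaugeGroup.dist1 (V b * (W b)⁻¹) ≤ 2 * Real.sqrt (F.L : ℝ) / Real.sqrt ((F.L : ℝ) ^ (j + 1)) * Real.sqrt Bx := by
    rw [hdist]
    refine hnorm.trans ?_
    have hXle : X ≤ Real.sqrt Bx := by rw [hXdef]; exact Real.sqrt_le_sqrt hXbox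
    have hρj : Real.sqrt ((((F.P K).L : ℝ) ^ (F.P K).d)⁻¹ * ((F.P K).L : ℝ) ^ 2) ^ j = Real.sqrt (F.L : ℝ) / Real.sqrt ((F.L : ℝ) ^ (j + 1)) := by
      rw [hd, hPL, eq_div_iff (Real.sqrt_pos.2 (by positivity)).ne']
      exact PoincareLipschitzAvgStabilitySmallData.rho_pow_mul_sqrt_eq hLpos j
    rw [hρj]
    have h2 : 0 ≤ 2 * (Real.sqrt (F.L : ℝ) / Real.sqrt ((F.L : ℝ) ^ (j + 1))) := by positivity
    calc 2 * (Real.sqrt (F.L : ℝ) / Real.sqrt ((F.L : ℝ) ^ (j + 1))) * X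
        ≤ 2 * (Real.sqrt (F.L : ℝ) / Real.sqrt ((F.L : ℝ) ^ (j + 1))) * _ := mul_le_mul_of_nonneg_left hXle h2
      _ = _ := by ring
  rw [hVdef, hWdef] at hgoal
  exact hgoal


/-- ★★★ **THE SAME, UNCONDITIONAL**: the two box-local rows are ✓`PoincareLipschitzTrueLinBoxLocalRows.sum_normSq_line_le_local` ∕
`sum_nbhd_le_local` (`ym3-torus-px7`, p683731), plugged by name — «average stability modulo gauge» holds in the small-data regime with no displayed
hypothesis. [cite: Balaban1985Averaging, Props 1-3 (122)-(126) p.36, (156)-(163)] -/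
theorem avgStabilityModGauge_smallData_rows :
    ∀ (L : ℕ), ∃ CS : ℝ, 0 ≤ CS ∧ ∃ cX : ℝ, 0 < cX ∧ ∀ (b₀ p₀ : ℝ), 0 < b₀ → 2 < p₀ → ∃ γ₁ : ℝ, 0 < γ₁ ∧ γ₁ ≤ 1 ∧
      ∀ (F : T3Family) (γ : ℝ), F.L = L → 0 < γ → γ ≤ γ₁ → ∀ (K j : ℕ), 1 ≤ j → j + 3 ≤ K →
      ∀ (a : Plaq (F.P K) (j + 1)) (U U' : GaugeField (F.P K) 0 (Matrix.specialUnitaryGroup (Fin 2) ℂ)),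
      (∀ (i : ℕ) (q : Plaq (F.P K) i), i < j + 1 →
        Site.tdist (fun k => ((((q.src k).val * F.L ^ i : ℕ)) : ZMod ((F.P K).sitesPerDir 0)))
          (fun k => ((((a.src k).val * F.L ^ (j + 1) : ℕ)) : ZMod ((F.P K).sitesPerDir 0))) + 64 * F.L ^ i ≤ 64 * F.L ^ (j + 1) →
        GaugeGroup.dist1 (GaugeField.plaqHol (Averaging.iter (fun i' => BlockAveraging.blockAvg (P := F.P K) (j := i') T3UnitLawDensityEML.ℰp) i U) q)
          < T3UnitScaleTilt.θBal F.L γ b₀ p₀ (K - i)) →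
      (∀ (i : ℕ) (q : Plaq (F.P K) i), i < j + 1 →
        Site.tdist (fun k => ((((q.src k).val * F.L ^ i : ℕ)) : ZMod ((F.P K).sitesPerDir 0)))
          (fun k => ((((a.src k).val * F.L ^ (j + 1) : ℕ)) : ZMod ((F.P K).sitesPerDir 0))) + 64 * F.L ^ i ≤ 64 * F.L ^ (j + 1) →
        GaugeGroup.dist1 (GaugeField.plaqHol (Averaging.iter (fun i' => BlockAveraging.blockAvg (P := F.P K) (j := i') T3UnitLawDensityEML.ℰp) i U') q)
          < T3UnitScaleTilt.θBal F.L γ b₀ p₀ (K - i)) →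
      Real.sqrt (∑ b : PBond (F.P K) 0, if (∀ k, (b.src k - ((((a.src k).val * F.L ^ (j + 1) : ℕ)) : ZMod ((F.P K).sitesPerDir 0)) +
            ((8 * F.L ^ (j + 1) : ℕ) : ZMod ((F.P K).sitesPerDir 0))).val < 17 * F.L ^ (j + 1)) ∧
          (∀ k, (b.tgt k - ((((a.src k).val * F.L ^ (j + 1) : ℕ)) : ZMod ((F.P K).sitesPerDir 0)) +
            ((8 * F.L ^ (j + 1) : ℕ) : ZMod ((F.P K).sitesPerDir 0))).val < 17 * F.L ^ (j + 1))
          then GaugeGroup.dist1 (U b * (U' b)⁻¹) ^ 2 else 0) ≤ cX →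
      ∃ h : GaugeTransf (F.P K) j (Matrix.specialUnitaryGroup (Fin 2) ℂ), ∀ c : PBond (F.P K) (j + 1),
        (c = ⟨a.src, a.μ⟩ ∨ c = ⟨a.src.shift a.μ, a.ν⟩ ∨ c = ⟨a.src.shift a.ν, a.μ⟩ ∨ c = ⟨a.src, a.ν⟩) →
        ∀ b : PBond (F.P K) j, (blockOf b.src = c.src ∨ blockOf b.src = c.tgt) → (blockOf b.tgt = c.src ∨ blockOf b.tgt = c.tgt) →
          GaugeGroup.dist1 (Averaging.iter (fun i' => BlockAveraging.blockAvg (P := F.P K) (j := i') T3UnitLawDensityEML.ℰp) j U b *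
              (GaugeField.gaugeAct h (Averaging.iter (fun i' => BlockAveraging.blockAvg (P := F.P K) (j := i') T3UnitLawDensityEML.ℰp) j U') b)⁻¹)
            ≤ CS / Real.sqrt ((F.L : ℝ) ^ (j + 1)) *
              Real.sqrt (∑ b : PBond (F.P K) 0, if (∀ k, (b.src k - ((((a.src k).val * F.L ^ (j + 1) : ℕ)) : ZMod ((F.P K).sitesPerDir 0)) +
                  ((8 * F.L ^ (j + 1) : ℕ) : ZMod ((F.P K).sitesPerDir 0))).val < 17 * F.L ^ (j + 1)) ∧
                (∀ k, (b.tgt k - ((((a.src k).val * F.L ^ (j + 1) : ℕ)) : ZMod ((F.P K).sitesPerDir 0)) +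
                  ((8 * F.L ^ (j + 1) : ℕ) : ZMod ((F.P K).sitesPerDir 0))).val < 17 * F.L ^ (j + 1))
                then GaugeGroup.dist1 (U b * (U' b)⁻¹) ^ 2 else 0) :=
  avgStabilityModGauge_smallData (fun _ _ hi V Z T S hS => sum_normSq_line_le_local hi V Z T S hS)
    (fun _ _ _ T S hS g hg => sum_nbhd_le_local T S hS g hg)

end Summit.QuantumFields.YangMills.Theorems.PoincareLipschitzAvgStabilitySmallData

end
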